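import Summits.ValiantsHypothesis.ValiantsHypothesis.Theorems.BarrierLeverHubToolkit
import Summits.ValiantsHypothesis.ValiantsHypothesis.Theorems.BarrierLeverCompressionMove

/-!
# Route BarrierLever — a first HUB CERTIFICATE: even code × claw at `h = 3` (TT, item 19152)

Demonstration file (`--supports stmt-ValiantsHypothesis-19152`; cell valiant-natproofs, rung V4, 𝒟-side of
door (c); prover gen 8, memo `HOME/prover/gen8/HUB-MEMO-g8.md` §2–§3). It certifies ONE layout of
`TransversalMinorLayoutsNonsingular` end to end through the new route — hub lemma + compression words — to
show that the pieces compose in the kernel; it does not import the route file.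

Layout: `h = 3`, `r = 4`, rows `u = (∅, {1,2}, {0,2}, {0,1})` (the even code), columns
`w = (∅, {0}, {1}, {2})` (the claw); in the item's encoding (row literal `a` if `a ∈ u i` else `3+a`, column
literal `3+c` if `c ∈ w j` else `c`) the index maps are `SU = ((3,4,5),(3,1,2),(0,4,2),(0,1,5))` and
`SW = ((0,1,2),(3,1,2),(0,4,2),(0,1,5))`. HUB `H = ((0,1,2),(0,1,4),(0,1,5),(0,2,4))` — a threshold family
for the weight `ψ = (4,3,2,0,2,1)` (member weights 9,9,8,8; every other increasing triple weighs ≤ 7), so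
`Hub.hub_unique_of_threshold` discharges the uniqueness hypothesis of `Hub.alive_trans_of_hub` by `decide`.
CERTIFICATE (found by `HOME/prover/gen8/compress_bfs.py`): `SU →C_{0←3}→ · →C_{1←5}→ H'`,
`SW →C_{0←2}→ · →C_{4←3}→ H''` with `H', H''` slot-permuted rearrangements of `H`; each arrow is one
application of gen 7's `PriorityPeeling.shearMove'` (no blocked member occurs; the general move is
`Compression.compressionMove`), the ends are `Hub.alive_of_rearrangement`, the two halves meet in
`Hub.alive_trans_of_hub` after `Hub.alive_symm`.

WHAT THIS IS NOT: one layout (already certified by the PP calculus as well); a format demonstration, not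
progress on the existence of certificates; nothing on crux stmt-ValiantsHypothesis-14610 or `VP` vs `VNP`.
-/

-- layout Summits/ValiantsHypothesis/ValiantsHypothesis forces the duplicated namespace component
set_option linter.dupNamespace false

namespace Summit.ValiantsHypothesis.ValiantsHypothesis.Theorems.BarrierLever.HubDemo

open Matrix PriorityPeeling Hub

/-- The hub `H = ((0,1,2),(0,1,4),(0,1,5),(0,2,4))` has strictly increasing rows. -/
theorem hub_strictMono : ∀ j : Fin 4,
    StrictMono ((![![0, 1, 2], ![0, 1, 4], ![0, 1, 5], ![0, 2, 4]] : Fin 4 → Fin 3 → Fin 6) j) := by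
  decide

/-- The hub is an injective family. -/
theorem hub_injective :
    Function.Injective (![![0, 1, 2], ![0, 1, 4], ![0, 1, 5], ![0, 2, 4]] : Fin 4 → Fin 3 → Fin 6) := by
  decide

set_option maxRecDepth 200000 in
/-- Threshold property of the hub for `ψ = (4,3,2,0,2,1)`: every increasing triple is a member or is
`ψ`-lighter than every member. -/
theorem hub_threshold : ∀ a : Fin 3 → Fin 6, StrictMono a →
    (∃ j : Fin 4, a = (![![0, 1, 2], ![0, 1, 4], ![0, 1, 5], ![0, 2, 4]] : Fin 4 → Fin 3 → Fin 6) j) ∨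
    ∀ j : Fin 4, (∑ c, (![4, 3, 2, 0, 2, 1] : Fin 6 → ℕ) (a c)) <
      ∑ c, (![4, 3, 2, 0, 2, 1] : Fin 6 → ℕ)
        ((![![0, 1, 2], ![0, 1, 4], ![0, 1, 5], ![0, 2, 4]] : Fin 4 → Fin 3 → Fin 6) j c) := by
  decide

/-- The uniqueness hypothesis of the hub lemma for `H`. -/
theorem hub_unique : ∀ H' : Fin 4 → Fin 3 → Fin 6, (∀ j, StrictMono (H' j)) → Function.Injective H' →
    (∑ j, ∑ a, (![4, 3, 2, 0, 2, 1] : Fin 6 → ℕ) (H' j a)) =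
      (∑ j, ∑ a, (![4, 3, 2, 0, 2, 1] : Fin 6 → ℕ)
        ((![![0, 1, 2], ![0, 1, 4], ![0, 1, 5], ![0, 2, 4]] : Fin 4 → Fin 3 → Fin 6) j a)) →
    ∃ σ : Equiv.Perm (Fin 4), ∀ j,
      H' j = (![![0, 1, 2], ![0, 1, 4], ![0, 1, 5], ![0, 2, 4]] : Fin 4 → Fin 3 → Fin 6) (σ j) :=
  fun H' hm hi hs => hub_unique_of_threshold _ _ hub_injective hub_threshold H' hm hi hs

/-- Rows side: `(SU, H)` is alive — word `C_{0←3} C_{1←5}` read backwards from a rearrangement of `H`. -/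
theorem alive_even_hub : ∃ G : Matrix (Fin 6) (Fin 6) ℂ, (Matrix.of fun i j : Fin 4 =>
    (G.submatrix ((![![3, 4, 5], ![3, 1, 2], ![0, 4, 2], ![0, 1, 5]] : Fin 4 → Fin 3 → Fin 6) i)
      ((![![0, 1, 2], ![0, 1, 4], ![0, 1, 5], ![0, 2, 4]] : Fin 4 → Fin 3 → Fin 6) j)).det).det ≠ 0 := by
  apply alive_symm
  -- step 1: C_{0←3} (shear x = 3 ↦ y = 0 on the columns containing 3 and not 0: columns 0, 1)
  refine shearMove' (ι := Fin 4)
    (![![0, 1, 2], ![0, 1, 4], ![0, 1, 5], ![0, 2, 4]] : Fin 4 → Fin 3 → Fin 6)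
    (![![3, 4, 5], ![3, 1, 2], ![0, 4, 2], ![0, 1, 5]] : Fin 4 → Fin 3 → Fin 6)
    (by decide) 3 0 (by decide) ![true, true, false, false] ![0, 0, 0, 0] (by decide) (by decide) ?_
  -- step 2: C_{1←5} (shear x = 5 ↦ y = 1 on column 0)
  refine shearMove' (ι := Fin 4)
    (![![0, 1, 2], ![0, 1, 4], ![0, 1, 5], ![0, 2, 4]] : Fin 4 → Fin 3 → Fin 6)
    (fun j => if (![true, true, false, false] : Fin 4 → Bool) j then
      Function.update ((![![3, 4, 5], ![3, 1, 2], ![0, 4, 2], ![0, 1, 5]] : Fin 4 → Fin 3 → Fin 6) j)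
        ((![0, 0, 0, 0] : Fin 4 → Fin 3) j) 0
      else (![![3, 4, 5], ![3, 1, 2], ![0, 4, 2], ![0, 1, 5]] : Fin 4 → Fin 3 → Fin 6) j)
    (by decide) 5 1 (by decide) ![true, false, false, false] ![2, 0, 0, 0] (by decide) (by decide) ?_
  -- end: the result is H rearranged (π = (0 1)(2 3), slots of members 1 and 3 swapped)
  exact alive_of_rearrangement _ _ hub_strictMono hub_injective
    (Equiv.swap 0 1 * Equiv.swap 2 3) ![Equiv.swap 1 2, 1, Equiv.swap 1 2, 1] (by decide)

/-- Columns side: `(SW, H)` is alive — word `C_{0←2} C_{4←3}`. -/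
theorem alive_claw_hub : ∃ G : Matrix (Fin 6) (Fin 6) ℂ, (Matrix.of fun i j : Fin 4 =>
    (G.submatrix ((![![0, 1, 2], ![3, 1, 2], ![0, 4, 2], ![0, 1, 5]] : Fin 4 → Fin 3 → Fin 6) i)
      ((![![0, 1, 2], ![0, 1, 4], ![0, 1, 5], ![0, 2, 4]] : Fin 4 → Fin 3 → Fin 6) j)).det).det ≠ 0 := by
  apply alive_symm
  -- step 1: C_{0←2} (shear x = 2 ↦ y = 0 on column 1)
  refine shearMove' (ι := Fin 4)
    (![![0, 1, 2], ![0, 1, 4], ![0, 1, 5], ![0, 2, 4]] : Fin 4 → Fin 3 → Fin 6)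
    (![![0, 1, 2], ![3, 1, 2], ![0, 4, 2], ![0, 1, 5]] : Fin 4 → Fin 3 → Fin 6)
    (by decide) 2 0 (by decide) ![false, true, false, false] ![0, 2, 0, 0] (by decide) (by decide) ?_
  -- step 2: C_{4←3} (shear x = 3 ↦ y = 4 on column 1)
  refine shearMove' (ι := Fin 4)
    (![![0, 1, 2], ![0, 1, 4], ![0, 1, 5], ![0, 2, 4]] : Fin 4 → Fin 3 → Fin 6)
    (fun j => if (![false, true, false, false] : Fin 4 → Bool) j then
      Function.update ((![![0, 1, 2], ![3, 1, 2], ![0, 4, 2], ![0, 1, 5]] : Fin 4 → Fin 3 → Fin 6) j)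
        ((![0, 2, 0, 0] : Fin 4 → Fin 3) j) 0
      else (![![0, 1, 2], ![3, 1, 2], ![0, 4, 2], ![0, 1, 5]] : Fin 4 → Fin 3 → Fin 6) j)
    (by decide) 3 4 (by decide) ![false, true, false, false] ![0, 0, 0, 0] (by decide) (by decide) ?_
  -- end: H rearranged (π = (2 3), member 1 with slots reversed, member 3 with slots 1,2 swapped)
  exact alive_of_rearrangement _ _ hub_strictMono hub_injective
    (Equiv.swap 2 3) ![1, Equiv.swap 0 2, Equiv.swap 1 2, 1] (by decide)

/-- **The layout (even code) × (claw) at `h = 3` is alive**, certified through the hub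
`H = ((0,1,2),(0,1,4),(0,1,5),(0,2,4))`: some `G` makes the `4 × 4` matrix of transversal minors
`det G[SU i, SW j]` nonsingular. -/
theorem evenCode_claw_alive : ∃ G : Matrix (Fin 6) (Fin 6) ℂ, (Matrix.of fun i j : Fin 4 =>
    (G.submatrix ((![![3, 4, 5], ![3, 1, 2], ![0, 4, 2], ![0, 1, 5]] : Fin 4 → Fin 3 → Fin 6) i)
      ((![![0, 1, 2], ![3, 1, 2], ![0, 4, 2], ![0, 1, 5]] : Fin 4 → Fin 3 → Fin 6) j)).det).det ≠ 0 :=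
  alive_trans_of_hub _ _ _ (![4, 3, 2, 0, 2, 1] : Fin 6 → ℕ) hub_strictMono hub_injective hub_unique
    alive_even_hub alive_claw_hub

/-- The same statement in the item's own indexing: `SU i a = if a ∈ u i then a else 3 + a` and
`SW j c = if c ∈ w j then 3 + c else c` for the even code `u` and the claw `w`. -/
theorem evenCode_claw_alive' : ∃ G : Matrix (Fin (3 + 3)) (Fin (3 + 3)) ℂ, (Matrix.of fun i j : Fin 4 =>
    (G.submatrix
      (fun a : Fin 3 => if a ∈ (![∅, {1, 2}, {0, 2}, {0, 1}] : Fin 4 → Finset (Fin 3)) i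
        then Fin.castAdd 3 a else Fin.natAdd 3 a)
      (fun c : Fin 3 => if c ∈ (![∅, {0}, {1}, {2}] : Fin 4 → Finset (Fin 3)) j
        then Fin.natAdd 3 c else Fin.castAdd 3 c)).det).det ≠ 0 := by
  have hr : (fun (i : Fin 4) (a : Fin 3) => if a ∈ (![∅, {1, 2}, {0, 2}, {0, 1}] : Fin 4 → Finset (Fin 3)) i
        then Fin.castAdd 3 a else Fin.natAdd 3 a) =
      (![![3, 4, 5], ![3, 1, 2], ![0, 4, 2], ![0, 1, 5]] : Fin 4 → Fin 3 → Fin 6) := by decide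
  have hc : (fun (j : Fin 4) (c : Fin 3) => if c ∈ (![∅, {0}, {1}, {2}] : Fin 4 → Finset (Fin 3)) j
        then Fin.natAdd 3 c else Fin.castAdd 3 c) =
      (![![0, 1, 2], ![3, 1, 2], ![0, 4, 2], ![0, 1, 5]] : Fin 4 → Fin 3 → Fin 6) := by decide
  obtain ⟨G, hG⟩ := evenCode_claw_alive
  refine ⟨G, ?_⟩
  have e1 : ∀ i : Fin 4, (fun a : Fin 3 => if a ∈ (![∅, {1, 2}, {0, 2}, {0, 1}] : Fin 4 → Finset (Fin 3)) i
        then Fin.castAdd 3 a else Fin.natAdd 3 a) =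
      (![![3, 4, 5], ![3, 1, 2], ![0, 4, 2], ![0, 1, 5]] : Fin 4 → Fin 3 → Fin 6) i :=
    fun i => congrFun hr i
  have e2 : ∀ j : Fin 4, (fun c : Fin 3 => if c ∈ (![∅, {0}, {1}, {2}] : Fin 4 → Finset (Fin 3)) j
        then Fin.natAdd 3 c else Fin.castAdd 3 c) =
      (![![0, 1, 2], ![3, 1, 2], ![0, 4, 2], ![0, 1, 5]] : Fin 4 → Fin 3 → Fin 6) j :=
    fun j => congrFun hc j
  simp only [e1, e2]
  exact hG

end Summit.ValiantsHypothesis.ValiantsHypothesis.Theorems.BarrierLever.HubDemo
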